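import Literature.AnabelianGeometry.Anabelioids.Basic
import Literature.AnabelianGeometry.Anabelioids.GaloisFullSubcategory
import Mathlib.CategoryTheory.ObjectProperty.FiniteProducts
import HarnessLib

/-!
# Anabelioids: proof of the named fact `image_galoisCategory` of `Anabelioids/Basic.lean`

Mochizuki, *The geometry of anabelioids*, Publ. RIMS **40** (2004), §1.1 p. 14
[cite: MochizukiGeoAn2004, §1.1 p.14]: for a morphism `φ : X → Y` of connected anabelioids,
"one verifies immediately that `I_φ` [the full subcategory of `X` on the subquotients of objects
`φ^* B`] is a connected anabelioid".  The statement file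
`Literature.AnabelianGeometry.Anabelioids.Basic` records this as the named fact
`image_galoisCategory`; this proof-only companion discharges it (`image_galoisCategory_holds`)
by the generic lemma `galoisCategory_fullSubcategory` (a full subcategory of a Galois category
stable under the Galois operations is Galois): the property "subquotient of some `φ^* B`" is
stable under

* terminal and initial objects and binary (co)products — `φ^*` is exact, products of
  epimorphisms are epimorphisms and coproducts of monomorphisms are monomorphisms in a Galois
  category (checked on a fibre functor);
* subobjects — the base change of an epimorphism is an epimorphism (fibre functor again) — hence
  pullbacks (a fibre product is a subobject of the product);
* quotients, in particular by finite groups of automorphisms.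

Proof-only: no definitions, nothing of the statement file is restated.
-/

namespace Literature.AnabelianGeometry.Anabelioids

open CategoryTheory CategoryTheory.Limits CategoryTheory.PreGaloisCategory

universe v₁ v₂ u₁ u₂

/-! ### Regularity properties of a Galois category, via a fibre functor -/

section Regularity

variable {C : Type u₁} [Category.{v₁} C] [GaloisCategory C]

/-- In a Galois category a product of two epimorphisms is an epimorphism (it is surjective on
fibres). [folklore] -/
private theorem epi_prod_map {S₁ S₂ A₁ A₂ : C} (q₁ : S₁ ⟶ A₁) (q₂ : S₂ ⟶ A₂) [Epi q₁] [Epi q₂] :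
    Epi (prod.map q₁ q₂) := by
  let F := GaloisCategory.getFiberFunctor C
  apply F.epi_of_epi_map
  apply ConcreteCategory.epi_of_surjective
  -- the fibre of a product is the product of the fibres
  have key : ∀ {Z₁ Z₂ : C} (x : F.obj (Z₁ ⨯ Z₂)),
      fiberBinaryProductEquiv F Z₁ Z₂ x = (F.map prod.fst x, F.map prod.snd x) := by
    intro Z₁ Z₂ x
    have hx : x = (fiberBinaryProductEquiv F Z₁ Z₂).symm
        ((fiberBinaryProductEquiv F Z₁ Z₂ x).1, (fiberBinaryProductEquiv F Z₁ Z₂ x).2) := by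
      simp
    conv_rhs => rw [hx]
    rw [fiberBinaryProductEquiv_symm_fst_apply, fiberBinaryProductEquiv_symm_snd_apply]
  have hinj : ∀ x y : F.obj (A₁ ⨯ A₂), F.map prod.fst x = F.map prod.fst y →
      F.map prod.snd x = F.map prod.snd y → x = y := by
    intro x y h₁ h₂
    apply (fiberBinaryProductEquiv F A₁ A₂).injective
    rw [key, key, h₁, h₂]
  intro t
  obtain ⟨s₁, hs₁⟩ := surjective_on_fiber_of_epi F q₁ (F.map prod.fst t)
  obtain ⟨s₂, hs₂⟩ := surjective_on_fiber_of_epi F q₂ (F.map prod.snd t)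
  refine ⟨(fiberBinaryProductEquiv F S₁ S₂).symm (s₁, s₂), hinj _ _ ?_ ?_⟩
  · rw [← FintypeCat.comp_apply, ← F.map_comp, prod.map_fst, F.map_comp, FintypeCat.comp_apply,
      fiberBinaryProductEquiv_symm_fst_apply, hs₁]
  · rw [← FintypeCat.comp_apply, ← F.map_comp, prod.map_snd, F.map_comp, FintypeCat.comp_apply,
      fiberBinaryProductEquiv_symm_snd_apply, hs₂]

/-- In a Galois category the base change of an epimorphism is an epimorphism (it is surjective on
fibres). [folklore] -/
private theorem epi_pullback_snd {S A A' : C} (q : S ⟶ A') (i : A ⟶ A') [Epi q] :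
    Epi (pullback.snd q i) := by
  let F := GaloisCategory.getFiberFunctor C
  apply F.epi_of_epi_map
  apply ConcreteCategory.epi_of_surjective
  intro a
  obtain ⟨s, hs⟩ := surjective_on_fiber_of_epi F q (F.map i a)
  exact ⟨(fiberPullbackEquiv F q i).symm ⟨(s, a), hs⟩, fiberPullbackEquiv_symm_snd_apply F s a hs⟩

/-- In a Galois category a coproduct of two monomorphisms is a monomorphism (it is injective on
fibres, the fibre of a coproduct being the disjoint union of the fibres). [folklore] -/
private theorem mono_coprod_map {S₁ S₂ T₁ T₂ : C} (i₁ : S₁ ⟶ T₁) (i₂ : S₂ ⟶ T₂) [Mono i₁]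
    [Mono i₂] : Mono (coprod.map i₁ i₂) := by
  let F := GaloisCategory.getFiberFunctor C
  apply F.mono_of_mono_map
  apply ConcreteCategory.mono_of_injective
  obtain ⟨-, -, hS⟩ :=
    fiber_binaryCofan F (coprod.inl : S₁ ⟶ S₁ ⨿ S₂) coprod.inr (coprodIsCoprod S₁ S₂)
  obtain ⟨hl, hr, hT⟩ :=
    fiber_binaryCofan F (coprod.inl : T₁ ⟶ T₁ ⨿ T₂) coprod.inr (coprodIsCoprod T₁ T₂)
  have hi₁ : Function.Injective (F.map i₁) :=
    ConcreteCategory.injective_of_mono_of_preservesPullback (F.map i₁)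
  have hi₂ : Function.Injective (F.map i₂) :=
    ConcreteCategory.injective_of_mono_of_preservesPullback (F.map i₂)
  have e₁ : ∀ s, F.map (coprod.map i₁ i₂) (F.map coprod.inl s) = F.map coprod.inl (F.map i₁ s) :=
    fun s => by
      rw [← FintypeCat.comp_apply, ← F.map_comp, coprod.inl_map, F.map_comp, FintypeCat.comp_apply]
  have e₂ : ∀ s, F.map (coprod.map i₁ i₂) (F.map coprod.inr s) = F.map coprod.inr (F.map i₂ s) :=
    fun s => by
      rw [← FintypeCat.comp_apply, ← F.map_comp, coprod.inr_map, F.map_comp, FintypeCat.comp_apply]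
  have cover : ∀ z : F.obj (S₁ ⨿ S₂),
      z ∈ Set.range (F.map (coprod.inl : S₁ ⟶ S₁ ⨿ S₂)) ∨
        z ∈ Set.range (F.map (coprod.inr : S₂ ⟶ S₁ ⨿ S₂)) := fun z => by
    have : z ∈ Set.range (F.map (coprod.inl : S₁ ⟶ S₁ ⨿ S₂)) ⊔
        Set.range (F.map (coprod.inr : S₂ ⟶ S₁ ⨿ S₂)) := by
      rw [hS.sup_eq_top]; trivial
    exact this
  intro x y hxy
  rcases cover x with ⟨s, rfl⟩ | ⟨s, rfl⟩ <;> rcases cover y with ⟨t, rfl⟩ | ⟨t, rfl⟩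
  · rw [e₁, e₁] at hxy
    rw [hi₁ (hl hxy)]
  · rw [e₁, e₂] at hxy
    exact (Set.disjoint_left.mp hT.disjoint ⟨F.map i₁ s, rfl⟩ ⟨F.map i₂ t, hxy.symm⟩).elim
  · rw [e₂, e₁] at hxy
    exact (Set.disjoint_left.mp hT.disjoint ⟨F.map i₁ t, rfl⟩ ⟨F.map i₂ s, hxy⟩).elim
  · rw [e₂, e₂] at hxy
    rw [hi₂ (hr hxy)]

omit [GaloisCategory C] in
/-- A fibre product is a subobject of the product. [folklore] -/
private theorem mono_prod_lift_pullback [HasBinaryProducts C] [HasPullbacks C] {A₁ A₂ Z : C}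
    (f : A₁ ⟶ Z) (g : A₂ ⟶ Z) : Mono (prod.lift (pullback.fst f g) (pullback.snd f g)) := by
  refine ⟨fun u v h => ?_⟩
  have h₁ := congrArg (· ≫ prod.fst) h
  have h₂ := congrArg (· ≫ prod.snd) h
  simp only [Category.assoc, prod.lift_fst, prod.lift_snd] at h₁ h₂
  exact pullback.hom_ext h₁ h₂

end Regularity

/-! ### Stability of "subquotient of some `φ^* B`" -/

section Image

variable {X : Type u₁} [Category.{v₁} X] {Y : Type u₂} [Category.{v₂} Y] [GaloisCategory X]
  [GaloisCategory Y] (φ : Hom X Y)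

omit [GaloisCategory X] [GaloisCategory Y] in
/-- Quotients of subquotients of `φ^* B` are subquotients. [folklore] -/
private theorem imageObj_of_epi {A A' : X} (g : A ⟶ A') (hg : Epi g)
    (hA : imageObj φ.pullback A) : imageObj φ.pullback A' := by
  obtain ⟨B, S, i, q, hi, hq⟩ := hA
  exact ⟨B, S, i, q ≫ g, hi, epi_comp _ _⟩

omit [GaloisCategory Y] in
/-- Subobjects of subquotients of `φ^* B` are subquotients (base change of the quotient map).
[folklore] -/
private theorem imageObj_of_mono {A A' : X} (i : A ⟶ A') [Mono i] (hA' : imageObj φ.pullback A') :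
    imageObj φ.pullback A := by
  obtain ⟨B, S, j, q, hj, hq⟩ := hA'
  haveI := epi_pullback_snd q i
  exact ⟨B, pullback q i, pullback.fst q i ≫ j, pullback.snd q i, mono_comp _ _, inferInstance⟩

omit [GaloisCategory X] [GaloisCategory Y] in
/-- `φ^* B` is a subquotient of itself. [folklore] -/
private theorem imageObj_obj (B : Y) : imageObj φ.pullback (φ.pullback.obj B) :=
  ⟨B, _, 𝟙 _, 𝟙 _, inferInstance, inferInstance⟩

/-- Binary products of subquotients are subquotients (`φ^*` preserves products; products of
epis are epi). [folklore] -/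
private theorem imageObj_prod {A₁ A₂ : X} (h₁ : imageObj φ.pullback A₁)
    (h₂ : imageObj φ.pullback A₂) : imageObj φ.pullback (A₁ ⨯ A₂) := by
  obtain ⟨B₁, S₁, i₁, q₁, hi₁, hq₁⟩ := h₁
  obtain ⟨B₂, S₂, i₂, q₂, hi₂, hq₂⟩ := h₂
  haveI := epi_prod_map q₁ q₂
  exact ⟨B₁ ⨯ B₂, S₁ ⨯ S₂, prod.map i₁ i₂ ≫ (PreservesLimitPair.iso φ.pullback B₁ B₂).inv,
    prod.map q₁ q₂, mono_comp _ _, inferInstance⟩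

/-- Binary coproducts of subquotients are subquotients (`φ^*` preserves coproducts; coproducts
of monos are mono). [folklore] -/
private theorem imageObj_coprod {A₁ A₂ : X} (h₁ : imageObj φ.pullback A₁)
    (h₂ : imageObj φ.pullback A₂) : imageObj φ.pullback (A₁ ⨿ A₂) := by
  obtain ⟨B₁, S₁, i₁, q₁, hi₁, hq₁⟩ := h₁
  obtain ⟨B₂, S₂, i₂, q₂, hi₂, hq₂⟩ := h₂
  haveI := mono_coprod_map i₁ i₂
  exact ⟨B₁ ⨿ B₂, S₁ ⨿ S₂, coprod.map i₁ i₂ ≫ (PreservesColimitPair.iso φ.pullback B₁ B₂).hom,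
    coprod.map q₁ q₂, mono_comp _ _, inferInstance⟩

omit [GaloisCategory X] in
/-- Stability under terminal objects. [folklore] -/
private theorem isClosed_terminal :
    (imageObj φ.pullback).IsClosedUnderLimitsOfShape (Discrete.{0} PEmpty) where
  limitsOfShape_le := by
    rintro A ⟨p⟩
    have hA : IsTerminal A :=
      (IsLimit.equivOfNatIsoOfIso p.diag.uniqueFromEmpty _ _
        (by exact Cone.ext (Iso.refl _) (by rintro ⟨⟨⟩⟩))).1 p.isLimit
    have hT : IsTerminal (φ.pullback.obj (⊤_ Y)) := terminalIsTerminal.isTerminalObj φ.pullback _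
    exact imageObj_of_epi φ (hT.uniqueUpToIso hA).hom inferInstance (imageObj_obj φ _)

/-- Stability under binary products. [folklore] -/
private theorem isClosed_binaryProducts : (imageObj φ.pullback).IsClosedUnderBinaryProducts where
  limitsOfShape_le := by
    rintro A ⟨p⟩
    let e : A ≅ p.diag.obj ⟨WalkingPair.left⟩ ⨯ p.diag.obj ⟨WalkingPair.right⟩ :=
      p.isLimit.conePointUniqueUpToIso (limit.isLimit p.diag) ≪≫
        HasLimit.isoOfNatIso (diagramIsoPair p.diag)
    exact imageObj_of_epi φ e.inv inferInstance
      (imageObj_prod φ (p.prop_diag_obj _) (p.prop_diag_obj _))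

/-- Stability under pullbacks (a fibre product is a subobject of the product). [folklore] -/
private theorem isClosed_pullbacks :
    (imageObj φ.pullback).IsClosedUnderLimitsOfShape WalkingCospan where
  limitsOfShape_le := by
    rintro A ⟨p⟩
    let e : A ≅ pullback (p.diag.map WalkingCospan.Hom.inl) (p.diag.map WalkingCospan.Hom.inr) :=
      p.isLimit.conePointUniqueUpToIso (limit.isLimit p.diag) ≪≫
        HasLimit.isoOfNatIso (diagramIsoCospan p.diag)
    have hprod := imageObj_prod φ (p.prop_diag_obj WalkingCospan.left)
      (p.prop_diag_obj WalkingCospan.right)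
    haveI := mono_prod_lift_pullback (p.diag.map WalkingCospan.Hom.inl)
      (p.diag.map WalkingCospan.Hom.inr)
    exact imageObj_of_epi φ e.inv inferInstance (imageObj_of_mono φ
      (prod.lift (pullback.fst (p.diag.map WalkingCospan.Hom.inl) (p.diag.map WalkingCospan.Hom.inr))
        (pullback.snd (p.diag.map WalkingCospan.Hom.inl) (p.diag.map WalkingCospan.Hom.inr))) hprod)

omit [GaloisCategory X] in
/-- Stability under initial objects. [folklore] -/
private theorem isClosed_initial :
    (imageObj φ.pullback).IsClosedUnderColimitsOfShape (Discrete.{0} PEmpty) where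
  colimitsOfShape_le := by
    rintro A ⟨p⟩
    have hA : IsInitial A :=
      (IsColimit.equivOfNatIsoOfIso p.diag.uniqueFromEmpty _ _
        (by exact Cocone.ext (Iso.refl _) (by rintro ⟨⟨⟩⟩))).1 p.isColimit
    have hI : IsInitial (φ.pullback.obj (⊥_ Y)) := initialIsInitial.isInitialObj φ.pullback _
    exact imageObj_of_epi φ (hI.uniqueUpToIso hA).hom inferInstance (imageObj_obj φ _)

/-- Stability under binary coproducts. [folklore] -/
private theorem isClosed_binaryCoproducts :
    (imageObj φ.pullback).IsClosedUnderBinaryCoproducts where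
  colimitsOfShape_le := by
    rintro A ⟨p⟩
    let e : p.diag.obj ⟨WalkingPair.left⟩ ⨿ p.diag.obj ⟨WalkingPair.right⟩ ≅ A :=
      (HasColimit.isoOfNatIso (diagramIsoPair p.diag)).symm ≪≫
        (colimit.isColimit p.diag).coconePointUniqueUpToIso p.isColimit
    exact imageObj_of_epi φ e.hom inferInstance
      (imageObj_coprod φ (p.prop_diag_obj _) (p.prop_diag_obj _))

omit [GaloisCategory X] [GaloisCategory Y] in
/-- Stability under quotients by (finite) groups of automorphisms: the colimit of a one-object
diagram is a quotient of that object. [folklore] -/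
private theorem isClosed_quotients (H : Type v₁) [Group H] [Finite H] :
    (imageObj φ.pullback).IsClosedUnderColimitsOfShape (SingleObj H) where
  colimitsOfShape_le := by
    rintro A ⟨p⟩
    have hepi : Epi (p.ι.app (SingleObj.star H)) :=
      ⟨fun u v huv => p.isColimit.hom_ext fun j => huv⟩
    exact imageObj_of_epi φ (p.ι.app (SingleObj.star H)) hepi (p.prop_diag_obj _)

end Image

/-- NAMED FACT `image_galoisCategory` ([GeoAn] §1.1 p. 14: "`I_φ` is a connected anabelioid"),
PROVED: for an exact `φ^* : Y ⥤ X` between Galois categories, the full subcategory of `X` on the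
subquotients of objects `φ^* B` is a Galois category — by `galoisCategory_fullSubcategory`, the
property being stable under the Galois operations. [cite: MochizukiGeoAn2004, §1.1 p.14] -/
theorem image_galoisCategory_holds : image_galoisCategory.{v₁, v₂, u₁, u₂} := by
  intro X _ Y _ _ _ φ
  haveI := isClosed_terminal φ
  haveI := isClosed_binaryProducts φ
  haveI := isClosed_pullbacks φ
  haveI := isClosed_initial φ
  haveI := isClosed_binaryCoproducts φ
  haveI : (imageObj φ.pullback).IsClosedUnderFiniteCoproducts :=
    ObjectProperty.IsClosedUnderFiniteCoproducts.mk'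
  exact galoisCategory_fullSubcategory (P := imageObj φ.pullback) (fun J _ => inferInstance)
    (fun H _ _ => isClosed_quotients φ H) (fun A A' i _ hA' => imageObj_of_mono φ i hA')

/-! ### Surjectivity of `π₁(X, β) → π₁(I_φ, ι ∘ β)` (appended)

[GeoAn] §1.1 p. 14: "the induced morphisms of fundamental groups `π₁(X) ↠ π₁(I_φ) ↪ π₁(Y)` are a
surjection followed by an injection" — the surjection half.  Since `I_φ` is closed under finite
(co)products and subobjects, an automorphism `τ` of the restricted fibre functor `ι ⋙ β` is
matched on any finite set of objects of `I_φ` by some `σ ∈ Aut(β)` (transitivity of `Aut(β)` on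
the fibre of the connected component of the tautological point of `S^{β(S)}`), and compactness of
`Aut(β)` yields a `σ` matching `τ` everywhere. -/

section Surjective

variable {X : Type u₁} [Category.{v₁} X] {Y : Type u₂} [Category.{v₂} Y] [GaloisCategory X]
  [GaloisCategory Y] (φ : Hom X Y)

/-- Subquotients of objects `φ^* B` are stable under finite products (exported form).
[cite: MochizukiGeoAn2004, §1.1 p.14] -/
theorem isClosedUnderFiniteProducts_imageObj :
    (imageObj φ.pullback).IsClosedUnderFiniteProducts := by
  haveI := isClosed_terminal φ
  haveI := isClosed_binaryProducts φ
  exact ObjectProperty.IsClosedUnderFiniteProducts.mk'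

/-- Subquotients of objects `φ^* B` are stable under finite coproducts (exported form).
[cite: MochizukiGeoAn2004, §1.1 p.14] -/
theorem isClosedUnderFiniteCoproducts_imageObj :
    (imageObj φ.pullback).IsClosedUnderFiniteCoproducts := by
  haveI := isClosed_initial φ
  haveI := isClosed_binaryCoproducts φ
  exact ObjectProperty.IsClosedUnderFiniteCoproducts.mk'

omit [GaloisCategory Y] in
/-- Subquotients of objects `φ^* B` are stable under subobjects (exported form).
[cite: MochizukiGeoAn2004, §1.1 p.14] -/
theorem imageObj_of_mono' {A A' : X} (i : A ⟶ A') [Mono i] (hA' : imageObj φ.pullback A') :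
    imageObj φ.pullback A :=
  imageObj_of_mono φ i hA'

/-- One object: an automorphism of `ι ⋙ β` agrees on the fibre of any single object `S` of `I_φ`
with some automorphism of `β` — transitivity of `Aut(β)` on the fibre of the connected component
of the tautological point of `S^{β(S)}`, plus naturality along the projections. [folklore] -/
private theorem exists_aut_eq_on (F : X ⥤ FintypeCat.{v₁}) [FiberFunctor F]
    (τ : Aut ((imageObj φ.pullback).ι ⋙ F)) (S : X) (hS : imageObj φ.pullback S) :
    ∃ σ : Aut F, ∀ s : F.obj S,
      σ.hom.app S s = τ.hom.app (⟨S, hS⟩ : Image φ.pullback) s := by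
  classical
  haveI := isClosedUnderFiniteProducts_imageObj φ
  -- the power `S^{F S}` and its tautological point
  let f : F.obj S → X := fun _ => S
  have hprod : imageObj φ.pullback (∏ᶜ f) := (imageObj φ.pullback).prop_product fun _ => hS
  let p : F.obj (∏ᶜ f) :=
    (PreservesProduct.iso F f).inv ((FintypeCat.productEquiv fun j => F.obj (f j)).symm fun s => s)
  have hp : ∀ s : F.obj S, F.map (Pi.π f s) p = s := by
    intro s
    change ((PreservesProduct.iso F f).inv ≫ F.map (Pi.π f s)) _ = s
    rw [← piComparison_comp_π, ← PreservesProduct.iso_hom, Iso.inv_hom_id_assoc]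
    exact FintypeCat.productEquiv_symm_comp_π_apply (fun j => F.obj (f j)) (fun s => s) s
  -- the connected component `B` of `p`, an object of `I_φ`
  obtain ⟨B, m, b, hb, hBc, hm⟩ := fiber_in_connected_component F (∏ᶜ f) p
  have hB : imageObj φ.pullback B := imageObj_of_mono φ m hprod
  -- transitivity of `Aut F` on the fibre of `B`
  obtain ⟨σ, hσ⟩ := MulAction.exists_smul_eq (Aut F) b
    (τ.hom.app (⟨B, hB⟩ : Image φ.pullback) b)
  have hσ' : σ.hom.app B b = τ.hom.app (⟨B, hB⟩ : Image φ.pullback) b := hσ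
  refine ⟨σ, fun s => ?_⟩
  -- naturality along `B ⟶ S^{F S} ⟶ S`
  let g : B ⟶ S := m ≫ Pi.π f s
  have hs : F.map g b = s := by
    change F.map (m ≫ Pi.π f s) b = s
    rw [F.map_comp, FintypeCat.comp_apply, hb, hp]
  have e₁ : σ.hom.app S (F.map g b) = F.map g (σ.hom.app B b) := by
    have := ConcreteCategory.congr_hom (σ.hom.naturality g) b
    simp only [FintypeCat.comp_apply] at this
    exact this
  have e₂ : τ.hom.app (⟨S, hS⟩ : Image φ.pullback) (F.map g b) =
      F.map g (τ.hom.app (⟨B, hB⟩ : Image φ.pullback) b) := by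
    have := ConcreteCategory.congr_hom
      (τ.hom.naturality (ObjectProperty.homMk g : (⟨B, hB⟩ : Image φ.pullback) ⟶ ⟨S, hS⟩)) b
    simp only [FintypeCat.comp_apply] at this
    exact this
  rw [← hs]
  exact e₁.trans ((congrArg (fun x => F.map g x) hσ').trans e₂.symm)

/-- Finitely many objects: an automorphism of `ι ⋙ β` agrees on the fibres of finitely many
objects of `I_φ` with some automorphism of `β` (apply the one-object case to their coproduct
and cancel the monic coprojections). [folklore] -/
private theorem exists_aut_eq_on_finset (F : X ⥤ FintypeCat.{v₁}) [FiberFunctor F]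
    (τ : Aut ((imageObj φ.pullback).ι ⋙ F)) (𝒜 : Finset (Image φ.pullback)) :
    ∃ σ : Aut F, ∀ A ∈ 𝒜, ∀ a : F.obj A.obj, σ.hom.app A.obj a = τ.hom.app A a := by
  classical
  haveI := isClosedUnderFiniteCoproducts_imageObj φ
  let f : {A : Image φ.pullback // A ∈ 𝒜} → X := fun A => A.1.obj
  have hS : imageObj φ.pullback (∐ f) :=
    (imageObj φ.pullback).prop_coproduct fun A => A.1.property
  obtain ⟨σ, hσ⟩ := exists_aut_eq_on φ F τ (∐ f) hS
  refine ⟨σ, fun A hA a => ?_⟩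
  let j : A.obj ⟶ ∐ f := Sigma.ι f ⟨A, hA⟩
  have hinj : Function.Injective (F.map j) :=
    ConcreteCategory.injective_of_mono_of_preservesPullback (F.map j)
  apply hinj
  have e₁ : F.map j (σ.hom.app A.obj a) = σ.hom.app (∐ f) (F.map j a) := by
    have := ConcreteCategory.congr_hom (σ.hom.naturality j) a
    simp only [FintypeCat.comp_apply] at this
    exact this.symm
  have e₂ : τ.hom.app (⟨∐ f, hS⟩ : Image φ.pullback) (F.map j a) = F.map j (τ.hom.app A a) := by
    have := ConcreteCategory.congr_hom
      (τ.hom.naturality (ObjectProperty.homMk j : A ⟶ ⟨∐ f, hS⟩)) a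
    simp only [FintypeCat.comp_apply] at this
    exact this
  exact e₁.trans ((hσ (F.map j a)).trans e₂)

/-- **The surjection half of [GeoAn] §1.1 p. 14** ("`π₁(X) ↠ π₁(I_φ)`"), PROVED: for an exact
`φ^* : Y ⥤ X` between Galois categories and a fibre functor `β` of `X`, restriction of
automorphisms `Aut(β) → Aut(ι ⋙ β)` to the image anabelioid `I_φ` is surjective.  Finite stages
by `exists_aut_eq_on_finset`; the stages are closed in the profinite group `Aut(β)`, so by
compactness some `σ` matches a given `τ` on every object. [cite: MochizukiGeoAn2004, §1.1 p.14] -/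
theorem pi1Map_imageIncl_surjective (F : X ⥤ FintypeCat.{v₁}) [FiberFunctor F] :
    Function.Surjective (pi1Map (imageObj φ.pullback).ι F) := by
  classical
  intro τ
  -- the closed stages
  let S : Finset (Image φ.pullback) → Set (Aut F) := fun 𝒜 =>
    {σ | ∀ A ∈ 𝒜, autEmbedding F σ A.obj = τ.app A}
  have hSne : ∀ 𝒜, (S 𝒜).Nonempty := fun 𝒜 => by
    obtain ⟨σ, hσ⟩ := exists_aut_eq_on_finset φ F τ 𝒜
    refine ⟨σ, fun A hA => ?_⟩
    rw [autEmbedding_apply]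
    apply Iso.ext
    apply FintypeCat.hom_ext
    intro a
    exact hσ A hA a
  have hSclosed : ∀ 𝒜, IsClosed (S 𝒜) := fun 𝒜 => by
    have : S 𝒜 = ⋂ A ∈ 𝒜, {σ | autEmbedding F σ A.obj = τ.app A} := by
      ext σ
      simp only [S, Set.mem_setOf_eq, Set.mem_iInter]
    rw [this]
    refine isClosed_biInter fun A _ => ?_
    haveI := aut_discreteTopology F A.obj
    exact isClosed_eq ((continuous_apply A.obj).comp continuous_induced_dom) continuous_const
  have hdir : Directed (· ⊇ ·) S := fun 𝒜 ℬ =>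
    ⟨𝒜 ∪ ℬ, fun σ hσ A hA => hσ A (Finset.mem_union_left _ hA),
      fun σ hσ A hA => hσ A (Finset.mem_union_right _ hA)⟩
  obtain ⟨σ, hσ⟩ := IsCompact.nonempty_iInter_of_directed_nonempty_isCompact_isClosed S hdir
    hSne (fun 𝒜 => (hSclosed 𝒜).isCompact) hSclosed
  refine ⟨σ, ?_⟩
  apply Iso.ext
  apply NatTrans.ext
  funext A
  have h := (Set.mem_iInter.mp hσ {A}) A (Finset.mem_singleton_self A)
  rw [autEmbedding_apply] at h
  rw [pi1Map_hom_app]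
  exact congrArg Iso.hom h

end Surjective

/-- NAMED FACT `image_factorization_surjective` ([GeoAn] §1.1 p. 14, surjection half of
`π₁(X) ↠ π₁(I_φ) ↪ π₁(Y)`), PROVED: `pi1Map_imageIncl_surjective`.
[cite: MochizukiGeoAn2004, §1.1 p.14] -/
theorem image_factorization_surjective_holds : image_factorization_surjective.{v₁, v₂, u₁, u₂} := by
  intro X _ Y _ _ _ φ F _
  exact pi1Map_imageIncl_surjective φ F

end Literature.AnabelianGeometry.Anabelioids
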